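import Summits.NavierStokesRegularity.NavierStokesRegularity.Theorems.SelfMixingDichotomyCoherentScaleExclusionKinWitnessPointwise

/-!
# Crux `SelfMixingDichotomy.CoherentScaleExclusion` (stmt-NavierStokesRegularity-1423), line
  `registered`: stub SSW1 `stub_selfSimilarSwirl_pointwise` — pointwise facts of the self-similar
  swirling eddy

Lands `--supports stmt-NavierStokesRegularity-1423` the registered stub `stub_selfSimilarSwirl_pointwise`
of the lead's regime-A kinematic witness: the exactly self-similar swirling core
`uA t x = (A (1 - t)⁻¹ · expNegInvGlue (4 - ‖x‖² / (1 - t))) • J x` for `t < 1` (and `0` for `t ≥ 1`),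
where `J x = (-x₁, x₀, 0) = WithLp.toLp 2 ![-(x 1), x 0, 0]`, blow-up time `1`, centre `0`, amplitude
`A ≥ 0`, core radius `2 √(1 - t)`.

Four facts are recorded (the registered statement writes the lambda out; no `def` is introduced):
1. SUPPORT: for `t < 1` and `‖x‖ ≥ 2 √(1 - t)` the field vanishes (`‖x‖² ≥ 4 (1 - t)`, so the
   argument of `expNegInvGlue` is `≤ 0`, `expNegInvGlue.zero_of_nonpos`).
2. TYPE-I BOUND: for `t < 1`, `√(1 - t) · ‖uA t x‖ ≤ 2 A` (`expNegInvGlue ≤ 1`, `‖J x‖ ≤ ‖x‖ < 2 √(1 - t)`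
   on the support, and `√s · s⁻¹ · 2 √s = 2`).
3. ENERGY: for `t ≥ 0` every time slice is in `L²` with `∫ ‖uA t x‖² ≤ 32 A² · |B₁|`
   (`|B₁| = (volume (ball 0 1)).toReal`): for `t ≥ 1` the slice is `0`; for `0 ≤ t < 1` it is
   continuous with support in `closedBall 0 (2 √(1 - t))` (`Continuous.memLp_of_hasCompactSupport`),
   and `‖uA‖² ≤ 4 A² / (1 - t)` on `ball 0 (2 √(1 - t))` gives
   `∫ ‖uA‖² ≤ 4 A² / (1 - t) · 8 (1 - t)^{3/2} |B₁| = 32 A² √(1 - t) |B₁| ≤ 32 A² |B₁|`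
   (`Measure.addHaar_ball`, `finrank_euclideanSpace_fin`).
4. UNBOUNDEDNESS (`A > 0`): for `ρ > 0` and `M : ℝ` there are `t ∈ (1 - ρ², 1)` and `x ∈ B(0, ρ)` with
   `‖uA t x‖ > M`: take `τ = 1 - t = min (ρ²/2) (d²)` with `d = A · expNegInvGlue 3 / (|M| + 1)` and
   `x = √τ e₀`; then `‖x‖² / τ = 1`, `J x = √τ e₁`, and `‖uA t x‖ = A · expNegInvGlue 3 / √τ ≥ |M| + 1`.

The helpers `kinWitness_pointwise_norm_rot_le` (`‖J x‖ ≤ ‖x‖`) and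
`kinWitness_pointwise_continuous_slice` of the sibling file `…KinWitnessPointwise` are reused; the other
helper theorems are stated for a generic parameter `s = 1 - t > 0`.
-/

noncomputable section

open MeasureTheory Metric

-- `Summit = Problem` for this summit; the tree lakefile sets `weak.linter.dupNamespace = false`.
set_option linter.dupNamespace false

namespace Summit.NavierStokesRegularity.NavierStokesRegularity.Theorems

/-- Off the core: if `s > 0` and `2 √s ≤ r` then `4 - r² / s ≤ 0`. -/
theorem selfSimilarSwirl_pointwise_arg_nonpos {s r : ℝ} (hs : 0 < s) (hr : 2 * Real.sqrt s ≤ r) :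
    4 - r ^ 2 / s ≤ 0 := by
  have h2 : (2 * Real.sqrt s) ^ 2 ≤ r ^ 2 := pow_le_pow_left₀ (by positivity) hr 2
  rw [mul_pow, Real.sq_sqrt hs.le] at h2
  rw [sub_nonpos, le_div_iff₀ hs]
  linarith

/-- SUPPORT of a slice: for `s > 0` and `2 √s ≤ ‖x‖` the slice
`(A s⁻¹ · expNegInvGlue (4 - ‖x‖²/s)) • J x` vanishes. -/
theorem selfSimilarSwirl_pointwise_slice_eq_zero (A : ℝ) {s : ℝ} (hs : 0 < s)
    {x : EuclideanSpace ℝ (Fin 3)} (hx : 2 * Real.sqrt s ≤ ‖x‖) :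
    (A * s⁻¹ * expNegInvGlue (4 - ‖x‖ ^ 2 / s)) •
      (WithLp.toLp 2 ![-(x 1), x 0, 0] : EuclideanSpace ℝ (Fin 3)) = 0 := by
  rw [expNegInvGlue.zero_of_nonpos (selfSimilarSwirl_pointwise_arg_nonpos hs hx), mul_zero,
    zero_smul]

/-- Crude size of a slice: `‖(A s⁻¹ · glue) • J x‖ ≤ A s⁻¹ · ‖x‖` (`0 ≤ glue ≤ 1`, `‖J x‖ ≤ ‖x‖`). -/
theorem selfSimilarSwirl_pointwise_norm_slice_le {A s : ℝ} (hA : 0 ≤ A) (hs : 0 < s)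
    (x : EuclideanSpace ℝ (Fin 3)) :
    ‖(A * s⁻¹ * expNegInvGlue (4 - ‖x‖ ^ 2 / s)) •
      (WithLp.toLp 2 ![-(x 1), x 0, 0] : EuclideanSpace ℝ (Fin 3))‖ ≤ A * s⁻¹ * ‖x‖ := by
  have hAs : 0 ≤ A * s⁻¹ := mul_nonneg hA (inv_nonneg.mpr hs.le)
  rw [norm_smul, Real.norm_eq_abs, abs_of_nonneg (mul_nonneg hAs (expNegInvGlue.nonneg _))]
  refine mul_le_mul ?_ (kinWitness_pointwise_norm_rot_le x) (norm_nonneg _) hAs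
  refine mul_le_of_le_one_right hAs ?_
  -- `expNegInvGlue y ≤ 1`: it is `0` for `y ≤ 0` and `exp (-y⁻¹) ≤ exp 0 = 1` for `y > 0`.
  unfold expNegInvGlue
  split_ifs with h
  · exact zero_le_one
  · exact Real.exp_le_one_iff.mpr (neg_nonpos.mpr (inv_nonneg.mpr (le_of_lt (not_le.mp h))))

/-- TYPE-I BOUND of a slice: `√s · ‖(A s⁻¹ · glue) • J x‖ ≤ 2 A` for `s > 0`, `A ≥ 0`. -/
theorem selfSimilarSwirl_pointwise_sqrt_mul_norm_slice_le {A s : ℝ} (hA : 0 ≤ A) (hs : 0 < s)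
    (x : EuclideanSpace ℝ (Fin 3)) :
    Real.sqrt s * ‖(A * s⁻¹ * expNegInvGlue (4 - ‖x‖ ^ 2 / s)) •
      (WithLp.toLp 2 ![-(x 1), x 0, 0] : EuclideanSpace ℝ (Fin 3))‖ ≤ 2 * A := by
  rcases le_or_gt (2 * Real.sqrt s) ‖x‖ with hx | hx
  · rw [selfSimilarSwirl_pointwise_slice_eq_zero A hs hx, norm_zero, mul_zero]
    positivity
  · have hss : Real.sqrt s * Real.sqrt s = s := Real.mul_self_sqrt hs.le
    calc Real.sqrt s * ‖(A * s⁻¹ * expNegInvGlue (4 - ‖x‖ ^ 2 / s)) •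
          (WithLp.toLp 2 ![-(x 1), x 0, 0] : EuclideanSpace ℝ (Fin 3))‖
        ≤ Real.sqrt s * (A * s⁻¹ * ‖x‖) :=
          mul_le_mul_of_nonneg_left (selfSimilarSwirl_pointwise_norm_slice_le hA hs x)
            (Real.sqrt_nonneg _)
      _ ≤ Real.sqrt s * (A * s⁻¹ * (2 * Real.sqrt s)) := by gcongr
      _ = 2 * A * (s⁻¹ * (Real.sqrt s * Real.sqrt s)) := by ring
      _ = 2 * A := by rw [hss, inv_mul_cancel₀ hs.ne', mul_one]

/-- ENERGY of a slice: for `0 < s ≤ 1` and `A ≥ 0` the slice is in `L²(ℝ³)` and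
`∫ ‖slice‖² ≤ 32 A² · (volume (ball 0 1)).toReal` (support in `closedBall 0 (2 √s)`,
`‖slice‖² ≤ 4 A²/s`, `volume (ball 0 R) = R³ · volume (ball 0 1)`, `(4 A²/s) · 8 s √s = 32 A² √s ≤ 32 A²`). -/
theorem selfSimilarSwirl_pointwise_energy_slice {A s : ℝ} (hA : 0 ≤ A) (hs : 0 < s) (hs1 : s ≤ 1) :
    MemLp (fun x : EuclideanSpace ℝ (Fin 3) =>
      (A * s⁻¹ * expNegInvGlue (4 - ‖x‖ ^ 2 / s)) •
        (WithLp.toLp 2 ![-(x 1), x 0, 0] : EuclideanSpace ℝ (Fin 3))) 2 volume ∧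
    ∫ x : EuclideanSpace ℝ (Fin 3), ‖(A * s⁻¹ * expNegInvGlue (4 - ‖x‖ ^ 2 / s)) •
        (WithLp.toLp 2 ![-(x 1), x 0, 0] : EuclideanSpace ℝ (Fin 3))‖ ^ 2
      ≤ 32 * A ^ 2 * (volume (ball (0 : EuclideanSpace ℝ (Fin 3)) 1)).toReal := by
  set f : EuclideanSpace ℝ (Fin 3) → EuclideanSpace ℝ (Fin 3) := fun x =>
    (A * s⁻¹ * expNegInvGlue (4 - ‖x‖ ^ 2 / s)) •
      (WithLp.toLp 2 ![-(x 1), x 0, 0] : EuclideanSpace ℝ (Fin 3)) with hf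
  set R : ℝ := 2 * Real.sqrt s with hR
  have hR0 : 0 ≤ R := by positivity
  have hcont : Continuous f := kinWitness_pointwise_continuous_slice _ _
  have hzero : ∀ x, R ≤ ‖x‖ → f x = 0 := fun x hx =>
    selfSimilarSwirl_pointwise_slice_eq_zero A hs hx
  have hsupp : Function.support f ⊆ closedBall 0 R := by
    intro x hx
    rw [Function.mem_support] at hx
    rw [mem_closedBall, dist_zero_right]
    by_contra h
    exact hx (hzero x (not_le.mp h).le)
  have hcs : HasCompactSupport f :=
    HasCompactSupport.of_support_subset_isCompact (isCompact_closedBall 0 R) hsupp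
  refine ⟨hcont.memLp_of_hasCompactSupport hcs, ?_⟩
  have hbound : ∀ x, ‖f x‖ ^ 2 ≤ 4 * A ^ 2 / s := by
    intro x
    have h := selfSimilarSwirl_pointwise_sqrt_mul_norm_slice_le hA hs x
    have h0 : 0 ≤ Real.sqrt s * ‖f x‖ := by positivity
    have h2 : (Real.sqrt s * ‖f x‖) ^ 2 ≤ (2 * A) ^ 2 := pow_le_pow_left₀ h0 h 2
    rw [mul_pow, Real.sq_sqrt hs.le] at h2
    rw [le_div_iff₀ hs]
    linarith
  have hvol : (volume (ball (0 : EuclideanSpace ℝ (Fin 3)) R)).toReal =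
      R ^ 3 * (volume (ball (0 : EuclideanSpace ℝ (Fin 3)) 1)).toReal := by
    rw [Measure.addHaar_ball volume 0 hR0, finrank_euclideanSpace_fin, ENNReal.toReal_mul,
      ENNReal.toReal_ofReal (by positivity)]
  have hR3 : R ^ 3 = 8 * (Real.sqrt s * s) := by
    have h3 : Real.sqrt s ^ 3 = Real.sqrt s * Real.sqrt s ^ 2 := by ring
    rw [hR, mul_pow, h3, Real.sq_sqrt hs.le]
    norm_num
  have h18 : Real.sqrt s ≤ 1 := Real.sqrt_le_one.mpr hs1
  have hV : 0 ≤ (volume (ball (0 : EuclideanSpace ℝ (Fin 3)) 1)).toReal := ENNReal.toReal_nonneg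
  calc ∫ x, ‖f x‖ ^ 2 = ∫ x in ball (0 : EuclideanSpace ℝ (Fin 3)) R, ‖f x‖ ^ 2 := by
        symm
        apply setIntegral_eq_integral_of_forall_compl_eq_zero
        intro x hx
        rw [mem_ball_zero_iff, not_lt] at hx
        rw [hzero x hx, norm_zero, zero_pow two_ne_zero]
    _ ≤ ‖∫ x in ball (0 : EuclideanSpace ℝ (Fin 3)) R, ‖f x‖ ^ 2‖ := Real.le_norm_self _
    _ ≤ 4 * A ^ 2 / s * volume.real (ball (0 : EuclideanSpace ℝ (Fin 3)) R) :=
        norm_setIntegral_le_of_norm_le_const measure_ball_lt_top fun x _ => by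
          rw [Real.norm_eq_abs, abs_of_nonneg (by positivity)]
          exact hbound x
    _ = 32 * A ^ 2 * Real.sqrt s * (volume (ball (0 : EuclideanSpace ℝ (Fin 3)) 1)).toReal := by
        rw [measureReal_def, hvol, hR3, div_mul_eq_mul_div, div_eq_iff hs.ne']
        ring
    _ ≤ 32 * A ^ 2 * 1 * (volume (ball (0 : EuclideanSpace ℝ (Fin 3)) 1)).toReal := by gcongr
    _ = 32 * A ^ 2 * (volume (ball (0 : EuclideanSpace ℝ (Fin 3)) 1)).toReal := by ring

/-- UNBOUNDEDNESS near `(1, 0)` for `A > 0`: for every `ρ > 0` and `M` there are `t ∈ (1 - ρ², 1)` and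
`x ∈ B(0, ρ)` with `‖uA t x‖ > M` (take `1 - t = τ = min (ρ²/2) d²`,
`d = A · expNegInvGlue 3 / (|M| + 1)`, `x = √τ e₀`: then `‖uA t x‖ = A · expNegInvGlue 3 / √τ ≥ |M| + 1`). -/
theorem selfSimilarSwirl_pointwise_unbounded {A : ℝ} (hA : 0 < A) {ρ : ℝ} (hρ : 0 < ρ) (M : ℝ) :
    ∃ t ∈ Set.Ioo (1 - ρ ^ 2) 1, ∃ x ∈ Metric.ball (0 : EuclideanSpace ℝ (Fin 3)) ρ,
      M < ‖(fun (t : ℝ) (x : EuclideanSpace ℝ (Fin 3)) => if t < 1 then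
        (A * (1 - t)⁻¹ * expNegInvGlue (4 - ‖x‖ ^ 2 / (1 - t))) •
          (WithLp.toLp 2 ![-(x 1), x 0, 0] : EuclideanSpace ℝ (Fin 3)) else 0) t x‖ := by
  set c : ℝ := A * expNegInvGlue 3 with hc
  have hc0 : 0 < c := mul_pos hA (expNegInvGlue.pos_of_pos (by norm_num))
  set d : ℝ := c / (|M| + 1) with hd
  have hM1 : 0 < |M| + 1 := by positivity
  have hd0 : 0 < d := div_pos hc0 hM1
  set τ : ℝ := min (ρ ^ 2 / 2) (d ^ 2) with hτ
  have hρ2 : 0 < ρ ^ 2 := by positivity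
  have hτ0 : 0 < τ := lt_min (by positivity) (by positivity)
  have hτρ : τ < ρ ^ 2 := (min_le_left _ _).trans_lt (by linarith)
  have hτd : τ ≤ d ^ 2 := min_le_right _ _
  have hsp : 0 < Real.sqrt τ := Real.sqrt_pos.mpr hτ0
  have hsτd : Real.sqrt τ ≤ d := (Real.sqrt_le_sqrt hτd).trans_eq (Real.sqrt_sq hd0.le)
  have hss : Real.sqrt τ * Real.sqrt τ = τ := Real.mul_self_sqrt hτ0.le
  set x : EuclideanSpace ℝ (Fin 3) := EuclideanSpace.single 0 (Real.sqrt τ) with hx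
  have hxn : ‖x‖ = Real.sqrt τ := by
    rw [hx, PiLp.norm_single, Real.norm_eq_abs, abs_of_nonneg hsp.le]
  have hJ : (WithLp.toLp 2 ![-(x 1), x 0, 0] : EuclideanSpace ℝ (Fin 3)) =
      EuclideanSpace.single 1 (Real.sqrt τ) := by
    ext i
    fin_cases i <;> simp [hx]
  refine ⟨1 - τ, ⟨by linarith, by linarith⟩, x, ?_, ?_⟩
  · rw [mem_ball_zero_iff, hxn]
    calc Real.sqrt τ < Real.sqrt (ρ ^ 2) := Real.sqrt_lt_sqrt hτ0.le hτρ
      _ = ρ := Real.sqrt_sq hρ.le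
  · have ht1 : 1 - τ < 1 := by linarith
    have h43 : (4 : ℝ) - 1 = 3 := by norm_num
    simp only [if_pos ht1, sub_sub_cancel]
    rw [hxn, Real.sq_sqrt hτ0.le, div_self hτ0.ne', h43, norm_smul, hJ, PiLp.norm_single,
      Real.norm_eq_abs, Real.norm_eq_abs, abs_of_nonneg hsp.le,
      abs_of_nonneg (mul_nonneg (mul_nonneg hA.le (inv_nonneg.mpr hτ0.le)) (expNegInvGlue.nonneg _))]
    -- goal: `M < A * τ⁻¹ * expNegInvGlue 3 * √τ`; it equals `c / √τ ≥ (|M| + 1) * d / √τ ... ≥ |M| + 1`.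
    have hval : A * τ⁻¹ * expNegInvGlue 3 * Real.sqrt τ = c / Real.sqrt τ := by
      rw [eq_div_iff hsp.ne', hc, mul_assoc, hss, mul_right_comm (A * τ⁻¹) _ τ,
        inv_mul_cancel_right₀ hτ0.ne']
    rw [hval, lt_div_iff₀ hsp]
    calc M * Real.sqrt τ ≤ |M| * Real.sqrt τ :=
          mul_le_mul_of_nonneg_right (le_abs_self M) hsp.le
      _ < |M| * Real.sqrt τ + Real.sqrt τ := lt_add_of_pos_right _ hsp
      _ = (|M| + 1) * Real.sqrt τ := by ring
      _ ≤ (|M| + 1) * d := mul_le_mul_of_nonneg_left hsτd hM1.le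
      _ = c := by rw [hd]; field_simp

/-- **SSW1 — stub `stub_selfSimilarSwirl_pointwise`** (crux stmt-NavierStokesRegularity-1423, line
`registered`): the pointwise facts of the self-similar swirling eddy
`uA t x = (A (1 - t)⁻¹ · expNegInvGlue (4 - ‖x‖²/(1 - t))) • (-x₁, x₀, 0)` (`t < 1`; `0` for `t ≥ 1`),
`A ≥ 0`: (i) it vanishes for `‖x‖ ≥ 2 √(1 - t)`; (ii) the Type-I bound `√(1 - t) · ‖uA t x‖ ≤ 2 A`;
(iii) a uniform energy bound `∫ ‖uA t ·‖² ≤ E₀` with every slice in `L²`, for `t ≥ 0`;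
(iv) for `A > 0`, unboundedness in every parabolic neighbourhood `(1 - ρ², 1) × B(0, ρ)` of `(1, 0)`. -/
theorem stub_selfSimilarSwirl_pointwise :
    ∀ A : ℝ, 0 ≤ A →
      (∀ (t : ℝ) (x : EuclideanSpace ℝ (Fin 3)), t < 1 → 2 * Real.sqrt (1 - t) ≤ ‖x‖ →
        (fun (t : ℝ) (x : EuclideanSpace ℝ (Fin 3)) => if t < 1 then
          (A * (1 - t)⁻¹ * expNegInvGlue (4 - ‖x‖ ^ 2 / (1 - t))) •
            (WithLp.toLp 2 ![-(x 1), x 0, 0] : EuclideanSpace ℝ (Fin 3)) else 0) t x = 0) ∧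
      (∀ (t : ℝ) (x : EuclideanSpace ℝ (Fin 3)), t < 1 →
        Real.sqrt (1 - t) * ‖(fun (t : ℝ) (x : EuclideanSpace ℝ (Fin 3)) => if t < 1 then
          (A * (1 - t)⁻¹ * expNegInvGlue (4 - ‖x‖ ^ 2 / (1 - t))) •
            (WithLp.toLp 2 ![-(x 1), x 0, 0] : EuclideanSpace ℝ (Fin 3)) else 0) t x‖ ≤ 2 * A) ∧
      (∃ E₀ : ℝ, ∀ t : ℝ, 0 ≤ t →
        MeasureTheory.MemLp ((fun (t : ℝ) (x : EuclideanSpace ℝ (Fin 3)) => if t < 1 then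
          (A * (1 - t)⁻¹ * expNegInvGlue (4 - ‖x‖ ^ 2 / (1 - t))) •
            (WithLp.toLp 2 ![-(x 1), x 0, 0] : EuclideanSpace ℝ (Fin 3)) else 0) t) 2 MeasureTheory.volume ∧
        ∫ x, ‖(fun (t : ℝ) (x : EuclideanSpace ℝ (Fin 3)) => if t < 1 then
          (A * (1 - t)⁻¹ * expNegInvGlue (4 - ‖x‖ ^ 2 / (1 - t))) •
            (WithLp.toLp 2 ![-(x 1), x 0, 0] : EuclideanSpace ℝ (Fin 3)) else 0) t x‖ ^ 2 ≤ E₀) ∧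
      (0 < A → ∀ ρ : ℝ, 0 < ρ → ∀ M : ℝ, ∃ t ∈ Set.Ioo (1 - ρ ^ 2) 1,
        ∃ x ∈ Metric.ball (0 : EuclideanSpace ℝ (Fin 3)) ρ,
        M < ‖(fun (t : ℝ) (x : EuclideanSpace ℝ (Fin 3)) => if t < 1 then
          (A * (1 - t)⁻¹ * expNegInvGlue (4 - ‖x‖ ^ 2 / (1 - t))) •
            (WithLp.toLp 2 ![-(x 1), x 0, 0] : EuclideanSpace ℝ (Fin 3)) else 0) t x‖) := by
  intro A hA
  refine ⟨fun t x ht hx => ?_, fun t x ht => ?_,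
    ⟨32 * A ^ 2 * (volume (ball (0 : EuclideanSpace ℝ (Fin 3)) 1)).toReal, fun t ht0 => ?_⟩,
    fun hA0 ρ hρ M => selfSimilarSwirl_pointwise_unbounded hA0 hρ M⟩
  · simp only [if_pos ht]
    exact selfSimilarSwirl_pointwise_slice_eq_zero A (sub_pos.mpr ht) hx
  · simp only [if_pos ht]
    exact selfSimilarSwirl_pointwise_sqrt_mul_norm_slice_le hA (sub_pos.mpr ht) x
  · by_cases ht : t < 1
    · simp only [if_pos ht]
      exact selfSimilarSwirl_pointwise_energy_slice hA (sub_pos.mpr ht) (by linarith)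
    · simp only [if_neg ht, norm_zero, ne_eq, OfNat.ofNat_ne_zero, not_false_eq_true, zero_pow,
        integral_zero]
      exact ⟨MemLp.zero', by positivity⟩

end Summit.NavierStokesRegularity.NavierStokesRegularity.Theorems
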